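import Summits.Ventures.HodgeRepro.Night1ProductWeilLineEigen
import Summits.Ventures.HodgeRepro.Night1ReducedLevelK

/-!
# One line, two products: the `σ`-line of the FULL corner product is carried onto the reduced set `U_σ` by the
twist map — the eigenspace forms of `Night1ProductWeilLineEigen` (on `B`) and of `Night1ReducedLevelK` /
`Night1WeilLineEigen` (on `∏_k A_{Φ k}` and on `B_red`) are the same Weil line

Blind re-derivation cell `pub-hodge-repro`, seat `night-1` (gen 3).  Imports `Night1ProductWeilLineEigen`
(p376653: the `σ`-line sets `lineSet σ = {(i, σ)} ⊆ ι × G` of the full corner product and their enumerations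
`lineEnum`) and `Night1ReducedLevelK` (the twist map `θ (i, x) = (cls i, x (tw i)⁻¹)`, the transfer
`isHodgeSetProd_image_twistMap_iff`, the reduced-side enumerations `reducedEnum` / `cosetEnum`).

* `image_lineSet_twistMap` — `θ (lineSet σ) = reducedSet cls tw σ`: the `σ`-line set of `W_F(B)` on the full
  product `B = ∏_i A_{Φ (cls i) · tw i}` is carried onto typer's reduced set `U_σ = {(cls i, σ (tw i)⁻¹)}`
  (`FaceReduce.reducedSet`) of the product of the representatives; `injOn_twistMap_lineSet` — `θ` is injective
  on every line when `(cls, tw)` is;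
* **`isHodgeSetProd_reducedSet_iff_lineSet`** — hence, for injective `(cls, tw)`: `U_σ` is a Pohlmann set of
  `∏_k A_{Φ k}` iff the `σ`-line set is a Pohlmann set of the full product `B` — so the two discharges of
  night-1 (g0's through Lemma R on `B_red`; g2's reduction-free on `B`) pull back the SAME Hodge line;
  `isHodgeSetProd_reducedSet_of_sumP'` re-derives `Night1ReducedLevelK.isHodgeSetProd_reducedSet_of_sumP`
  from the full-product line `isHodgeSetProd_lineSet_of_sumP` through the transfer;
* the enumerations agree by `rfl`: `reducedEnum cls tw e σ = θ ∘ lineEnum e σ`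
  (`reducedEnum_eq_twistMap_comp_lineEnum`), `cosetEnum Φ cls tw e σ = cosetMap Φ ∘ θ ∘ lineEnum e σ`
  (`cosetEnum_eq`), and g0's `weilEnum Φ cls tw σ = cosetMap Φ ∘ θ ∘ lineEnum (Equiv.refl (Fin 4)) σ`
  (`weilEnum_eq_cosetMap_twistMap_lineEnum`); `image_cosetMap_reducedSet_eq` — the point set of g0's reduced-side
  Weil line on the coset `G`-set is the image of the `σ`-line set under `cosetMap Φ ∘ θ`.

Nothing geometric is built (the isogenies are named, not constructed); every statement is about the `G`-set
model.  Nothing here says anything about the status of the Hodge conjecture for CM abelian varieties, which is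
NOT proved.
-/

set_option autoImplicit false

open Finset
open scoped Pointwise

namespace HodgeRepro.RouteC

variable {G : Type*} [Group G] [DecidableEq G] [Fintype G] {ι J : Type*} [Fintype ι] [DecidableEq ι]
  [DecidableEq J]

omit [Fintype G] in
/-- **The `σ`-line of the full product is carried onto the reduced set `U_σ`**: `θ (lineSet σ) = {(cls i,
σ (tw i)⁻¹)} = reducedSet cls tw σ`. -/
theorem image_lineSet_twistMap (cls : ι → J) (tw : ι → G) (σ : G) :
    (lineSet (ι := ι) σ).image (twistMap cls tw) = reducedSet cls tw σ := by
  rw [lineSet, image_image, reducedSet]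
  rfl

omit [Fintype G] [DecidableEq J] in
/-- The twist map is injective on every `σ`-line when `(cls, tw)` is injective. -/
theorem injOn_twistMap_lineSet {cls : ι → J} {tw : ι → G}
    (hinj : Function.Injective fun i => (cls i, tw i)) (σ : G) :
    Set.InjOn (twistMap cls tw) (lineSet (ι := ι) σ) := by
  intro q hq q' hq' h
  rw [Finset.mem_coe, mem_lineSet] at hq hq'
  simp only [twistMap_apply, Prod.mk.injEq] at h
  rw [hq, hq', mul_left_cancel_iff, inv_inj] at h
  have : (cls q.1, tw q.1) = (cls q'.1, tw q'.1) := Prod.ext h.1 h.2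
  exact Prod.ext (hinj this) (hq.trans hq'.symm)

omit [Fintype G] in
/-- **One line, two products (Pohlmann-wise)**: for injective `(cls, tw)`, the reduced set `U_σ` is a Pohlmann
set of the product `∏_k A_{Φ k}` of the representatives iff the `σ`-line set is a Pohlmann set of the full
corner product `∏_i A_{Φ (cls i) · tw i}`. -/
theorem isHodgeSetProd_reducedSet_iff_lineSet {c : G} (hc : IsComplexConj c) (Φ : J → Finset G)
    {cls : ι → J} {tw : ι → G} (hinj : Function.Injective fun i => (cls i, tw i)) (σ : G) :
    IsHodgeSetProd c Φ (reducedSet cls tw σ) ↔ IsHodgeSetProd c (corner Φ cls tw) (lineSet (ι := ι) σ) := by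
  rw [← image_lineSet_twistMap cls tw σ]
  exact isHodgeSetProd_image_twistMap_iff hc Φ cls tw (injOn_twistMap_lineSet hinj σ)

omit [Fintype G] in
/-- `Night1ReducedLevelK.isHodgeSetProd_reducedSet_of_sumP` re-derived from the full-product line
`isHodgeSetProd_lineSet_of_sumP` through the transfer (the two proofs are the same count, read on `B` and on
`∏_k A_{Φ k}`). -/
theorem isHodgeSetProd_reducedSet_of_sumP' {c : G} (hc : IsComplexConj c) (Φ : J → Finset G)
    {cls : ι → J} {tw : ι → G} (hinj : Function.Injective fun i => (cls i, tw i)) {k : ℕ}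
    (hsum : SumP k (corner Φ cls tw)) (σ : G) : IsHodgeSetProd c Φ (reducedSet cls tw σ) :=
  (isHodgeSetProd_reducedSet_iff_lineSet hc Φ hinj σ).2 (isHodgeSetProd_lineSet_of_sumP hc hsum σ)

omit [DecidableEq G] [Fintype G] [Fintype ι] [DecidableEq ι] [DecidableEq J] in
/-- The reduced-side enumeration is the twist map after the line enumeration. -/
theorem reducedEnum_eq_twistMap_comp_lineEnum (cls : ι → J) (tw : ι → G) {k : ℕ} (e : Fin (2 * k) ≃ ι)
    (σ : G) : reducedEnum cls tw e σ = twistMap cls tw ∘ lineEnum e σ := rfl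

omit [DecidableEq G] [Fintype G] [Fintype ι] [DecidableEq ι] [DecidableEq J] in
/-- The coset enumeration is the coset map after the twist map after the line enumeration. -/
theorem cosetEnum_eq (Φ : J → Finset G) (cls : ι → J) (tw : ι → G) {k : ℕ} (e : Fin (2 * k) ≃ ι)
    (σ : G) : cosetEnum Φ cls tw e σ = cosetMap Φ ∘ twistMap cls tw ∘ lineEnum e σ := rfl

omit [DecidableEq G] [Fintype G] [Fintype ι] [DecidableEq ι] [DecidableEq J] in
/-- **g0's reduced-side enumeration is the image of the full-product line**: `weilEnum Φ cls tw σ`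
(`Night1WeilLineEigen`, the four points `⟨cls i, σ (tw i)⁻¹ · rstab⟩` of the coset `G`-set of `B_red`) is
`cosetMap Φ ∘ twistMap cls tw ∘ lineEnum (Equiv.refl (Fin 4)) σ`. -/
theorem weilEnum_eq_cosetMap_twistMap_lineEnum (Φ : J → Finset G) (cls : Fin 4 → J) (tw : Fin 4 → G)
    (σ : G) :
    weilEnum Φ cls tw σ = cosetMap Φ ∘ twistMap cls tw ∘ lineEnum (Equiv.refl (Fin 4)) σ := rfl

omit [Fintype G] in
/-- The point set of g0's reduced-side Weil line on the coset `G`-set is the image of the `σ`-line set under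
`cosetMap Φ ∘ θ`. -/
theorem image_cosetMap_reducedSet_eq (Φ : J → Finset G) (cls : ι → J) (tw : ι → G) (σ : G) :
    (reducedSet cls tw σ).image (cosetMap Φ) =
      (lineSet (ι := ι) σ).image (cosetMap Φ ∘ twistMap cls tw) := by
  rw [← image_lineSet_twistMap cls tw σ, image_image]

end HodgeRepro.RouteC
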